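import Summits.QuantumFields.BalabanUV.T4Continuum.Support.NE9TablePolydiscSP
import Summits.QuantumFields.BalabanUV.T4Continuum.Support.NE9PencilSizeInduction

/-!
# NE9TablePolydiscSPEnd — ROUTE R3′♯-SP, PART 2 (the END, DOCKED): E129 `NE9PencilEndSharpVacuum`'s record-shape END re-threaded at PART 1's
# table-polydisc constant — `OutputLipschitz … (fun k ↦ 2·B₀ k·R₀∕(R₀² − s₀²))`, rate `ω + 2B·τ̄∕(R₀ − s₀)` ↦ `ω + 2B·R₀·τ̄∕(R₀² − s₀²)`, SAME
# displayed instance list as E129 (p256132) plus the scalar `0 ≤ s₀` — in BOTH of R3′'s record forms: E129's (`hocc` displayed; §3∕§3b = T19's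
# station) and `NE9PencilSizeInduction`'s (p258374; occupation DERIVED from the size block; §3c, NEW)

Cell `pub-balaban`, T4-DAG §6 row NE9; NE9 crux team (coordinator ruling «YM REDIRECT» e34b3e0c (2)), leaf lineage
`b2b-balaban-t4-ne9-formalise-leaf-06` generation 40; route R3′ «pencil ∕ potential-KPG» of `t4/ROUTES-NE9.md` v8.0.1 §L1.3 ADDENDUM «R3′♯-SP»
(co-lead, rank 2 of record).  ENGINE AND AUTHORSHIP OF THE LEAN BELOW: the crux-ideation seat `b2b-balaban-t4-ne9-idea-1` generation 8 (lens 1 =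
analytic dependence ∕ implicit-function ∕ fixed-point operators), HOME scratch `t4/ideate/NE9/lens1-NE9TablePolydiscSP.lean` sha16 1bacbd220ebeef05
(215 l.; kernel-checked rc 0 ∣ 0 ∣ 0, axioms {propext, Classical.choice, Quot.sound} by its author, by the pricing desk `t4-ne9-refuter` g10
(PRICING-NE9 v10 §B «F-v10-1: CORRECT, SHARP for its data class, same instance list + `0 ≤ s₀`») and by this seat) — reproduced VERBATIM under
the tree namespace (only the namespace, the split into two ≤ 400-l. files and the headers differ; docstrings kept), FILED by leaf-06 as the
refuter's open item **O-v8-SP** («dock ≈ 150 l. — owner or leaf-06 or nobody; T19 lettered for both») after the row OWNER `t4-ne9-p1` g61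
DECLINED it for his lineage («R3′-side constant work; leaf-06∕idea-1's if anyone's», journal l.29955) and idea-1 g8 deferred («the OWNER's ∕
leaf-06's call, not mine», l.29577); journal INTENT 1 l.29979.
§3c is NEW (leaf-06): the same END in `NE9PencilSizeInduction`'s OCCUPATION-DERIVED form (p258374 §3∕§4 twins).

PRICING (the refuter's letters `z := p̄₀∕B`, `S := R₀∕s_occ`; PRICING-NE9 v10 §B(B10-4); `calc` GRAMMAR G20 v2.4 — three independent codes):
`c_eff = 2` (E129) ↦ `c_eff(S) = 2S∕(S+1)` = `48∕37` at print's box `S = 24∕13`; ALIVE iff `2S < (2+z)(S²−1)` ⇔ `z > −190∕407`, i.e. for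
EVERY `z ≥ 0` WITHOUT an ε₁-purchase (E129: `z > 4∕11`); rate `μ_SP = ω̂ + (2∕(2+z))(1−ω)S∕(S²−1)`, RATE-LEADS R4-of-record (`θ = ω̂ + (1−ω)∕S`)
iff `z > 2∕(S²−1) = 338∕407` (E129: `26∕11`); §4 certifies the rational rows by `norm_num`.  These are PRICES of CONDITIONAL ENDs — a sharper
constant inside a conditional END is NOT progress on the estimate NE9 itself.  TRIGGER T19 (refuter v10 §H) is lettered on this file's ACCEPT:
the binder diff of §3b `ne9_and_fadingMemory_of_potentialKPG_psiOf_SP` against E129 `…_potentialKPG_psiOf` reads «+`hs₀`, conclusion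
`2 * B ∕ (R₀ − s₀) ↦ 2 * B * R₀ ∕ (R₀ ^ 2 − s₀ ^ 2)`» (P-R3-7, pre-confirmed by the desk on the scratch bytes, which §3b reproduces).

HONEST FRAMING (T4-DAG PAGE 1).  Rung (B)+1 of the FINITE-VOLUME T⁴ programme — NOT infinite volume, NOT a mass gap, NOT the Clay problem.  NE9
(`T4OutputRate.NE9` ∧ `FadingMemory`) is a cell NEW ESTIMATE, NOT PRINTED in [I] = [Balaban1987RG1] (CMP **109**), [II] = [Balaban1988RG2Cluster]
(CMP **116**), NOT PROVED for Bałaban's E^{(j)}: every END of the route is «NE9 ⇐ the named binders» (potential-KPG = line-holomorphy + majorant on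
the table ball `‖Q‖ < R₀` AT EVERY BACKGROUND incl. `U₀` = the (R-0)[scope] clause, typed as `NE9PencilScope238` (E133 p258881), + KP for `m`;
`hdec`, `hpin`, `hocc` or the size block, the reading law, the structural binders, and the COUPLING HALF `hlast` — whose own suppliers keep
`TwoPointKP` (KP for `2n`) ∕ `hCup` ∕ `hTcup` — all DISPLAYED); W1 = the model O-NE9-1 untouched (PARKED under FREEZE (0)); the displays `z`, `S`
are ε₁-dials of an instancer that does not exist; row NE9 WALLED ON A MODEL; spine PROVED 0∕9.  HONEST DEPENDENCY (cell line, verbatim):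
continuum YM on T⁴ ⇐ BetaPertH ∧ nine spine estimates (0/9 proved); BetaPertH ⇐ (D1) ∧ (D4) ∧ CAP+tail; G-an2-4 gates asym, D1 and NE2/3/4.
`FlowStep.BetaPertH`, (B), (B^μ) do not occur; [I]∕[II] for TYPES only (ABSOLUTE RULE).

CONTENT ([folklore]; 0 def, 0 Prop-valued definition, 0 sorry):
* §3 (idea-1) `outputLipschitz_of_potentialKPG_SP_vac` (`fun k ↦ 2·B₀ k·R₀∕(R₀² − s₀²)`; the explicit part cancels, both cluster sums by PART 1
  §2), `outerLipschitz_of_potentialKPG_SP_vac`, **`ne9_and_fadingMemory_of_potentialKPG_perStep_SP_vac`** (E129 §1's binder list VERBATIM at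
  `Pot := ℓ^∞(A;ℂ)` + `hs₀ : 0 ≤ s₀`, `hpos` re-targeted ⊢ rate `ω + 2B·R₀∕(R₀² − s₀²)·τ̄`), `fade_iff_room_SP_vac` (fades iff
  `2B·τ̄·R₀ < (R₀² − s₀²)(1 − ω)`), `room_SP_of_room_sharp` (E129's room implies the SP room — the life region only GROWS).
* §3b (idea-1) **`ne9_and_fadingMemory_of_potentialKPG_psiOf_SP`** — the record junction: §3 at `Ψ := NE9EndApplied.ΨOf`, reading `readingρ wt`,
  `hΨv` by `rfl`.
* §3c (leaf-06, NEW) **`ne9_and_fadingMemory_of_potentialKPG_vacSub_sizeInduction_SP`** ∕ **`…_sizeInduction_psiOf_SP`** — p258374 §3∕§4's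
  binder lists VERBATIM + `hs₀`, `hpos` re-targeted ⊢ `TermSize E W κ N ∧ NE9 … ∧ FadingMemory …` at the SP rate; the occupation DERIVED from
  (B0) `hbase`, (XZ) `hexplZ`, (N′) `hNsucc`, `hNnn`, (R′) `hbox` and the box `h𝒜 : 𝒜 k ⊆ closedBall 0 s₀` by p258374 §2 (KP for `m` only).
* §4 (idea-1) pricing arithmetic as `example`s (`norm_num`; no declarations).
DISGUISE TEST: composition over PART 1, E129 and p258374; no history beyond the displayed binders; nothing of Bałaban's asserted; no named fact.
WHAT THIS DOES NOT DO: touches no activity, no species, no estimate of the series; `PotentialKPG`, decay, pin budget, occupation ∕ size data,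
box, reading law, `hlast` stay DISPLAYED; the model O-NE9-1, the (R-0)[scope] provenance question and the displays `z`, `S` untouched; the
coupling half (L) still carries whatever its own supplier displays; E129 ∕ p258374 are imported BY NAME and NOT modified.

References (TYPES ∕ loci only): [Balaban1987RG1] T. Bałaban, CMP **109** (1987) 249–301 — (0.23) p. 256, (2.13)–(2.14) p. 268;
[Balaban1988RG2Cluster] T. Bałaban, CMP **116** (1988) 1–22 — (1.36) p. 9, Lemma 3 (2.38) p. 20, (2.40)–(2.41) p. 21; [KoteckyPreiss1986]
CMP **103** (1986) 491–498, p. 492–493; [FV1980] T. Franzoni, E. Vesentini, *Holomorphic Maps and Invariant Distances*, North-Holland Math.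
Studies 40 (1980), ch. V §5 (polydisc Schwarz–Pick); [Harris1979] L. A. Harris, North-Holland Math. Studies 34 (1979) 345–406.
Summits-side NEW work (LEAN PLACEMENT RULE); imports PART 1 `NE9TablePolydiscSP` and `NE9PencilSizeInduction` (leaf-06; transitively the owner's
E128∕E129 `NE9PencilEndSharp`∕`NE9PencilEndSharpVacuum` and `NE9EndApplied`) BY NAME; modifies nothing; 0 sorry.  Value = route R3′'s
conditional END docked at the refuter-priced sharp table-half constant (O-v8-SP ∕ T19), NOT summit progress.
-/

noncomputable section

namespace Summit.QuantumFields.BalabanUV.T4Continuum.NE9TablePolydiscSPEnd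

open Metric Set
open scoped BigOperators ENNReal
open Literature.Probability.LatticeModels
open Literature.MathematicalPhysics.QuantumFieldTheory.Balaban1983to89
open Literature.MathematicalPhysics.QuantumFieldTheory.Balaban1983to89.T4OutputRate
open Literature.MathematicalPhysics.QuantumFieldTheory.Balaban1983to89.T4ActivityLipschitz
open Literature.MathematicalPhysics.QuantumFieldTheory.Balaban1983to89.T4HistoryLipschitzRecursion
open Literature.MathematicalPhysics.QuantumFieldTheory.Balaban1983to89.T4HistoryLipschitzOuter
open Literature.MathematicalPhysics.QuantumFieldTheory.Balaban1983to89.T4HistoryLipschitzActivity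
open Literature.MathematicalPhysics.QuantumFieldTheory.Balaban1983to89.T4HistoryLipschitzActivity (ClusterGeom)
open Literature.MathematicalPhysics.QuantumFieldTheory.Balaban1983to89.T4HistoryLipschitzSegment (sizeRadius TermSize)
open Summit.QuantumFields.BalabanUV.T4Continuum.NE9TablePolydiscSP (norm_clusterSum_sub_le_of_ballKPG_SP)

variable {A : Type*}

/-! ## §3 E129's vacuum-subtracted END re-threaded at the table-polydisc constant `2·B₀ k·R₀∕(R₀² − s₀²)` -/

section EndSP

variable {C : Carriers} (G : ClusterGeom C) {Bg : Type}

/-- **`OutputLipschitz` FROM POTENTIAL-KPG ON THE RECORD's SHAPE AT THE TABLE-POLYDISC CONSTANT `2·B₀ k·R₀∕(R₀² − s₀²)`**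
(E129 `NE9PencilEndSharpVacuum.outputLipschitz_of_potentialKPG_sharp_vac`'s binder list VERBATIM at `Pot := ℓ^∞(A;ℂ)`; its
`2·B₀ k∕(R₀ − s₀)` ↦ `2·B₀ k·R₀∕(R₀² − s₀²)`).  «⇐ the named binders».
[cite: Balaban1987RG1, (2.13)-(2.14) p.268; Balaban1988RG2Cluster, Lemma 3 (2.38) p.20 and (2.40)-(2.41) p.21] -/
theorem outputLipschitz_of_potentialKPG_SP_vac {ι : Type} {E : Functional C Bg} {W : Set (ℕ → ℝ)}
    {T : ℕ → (ℕ → ℝ) → (Bg → C.Dom → ℝ) → ι → ℝ} {Ψ : ℕ → ℝ → (ι → ℝ) → Bg → C.Dom → ℝ}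
    {act : ℕ → ℝ → Bg → lp (fun _ : A => ℂ) ∞ → G.P → ℂ} {m : ℕ → ℝ → Bg → G.P → ℝ} {a d : G.P → ℝ} {δ : C.Dom → ℝ}
    {B₀ : ℕ → ℝ} {κ s₀ R₀ : ℝ} {wt : ℕ → ι → ℝ} {U₀ : Bg} {explZ : ℕ → Bg → C.Dom → ℝ}
    (ρ : ℕ → (ι → ℝ) → lp (fun _ : A => ℂ) ∞)
    (hKP : G.PotentialKPG W act m a d R₀) (hdec : G.DecayExtract δ d) (hpin : G.PinBudget a δ B₀ κ) (hsR : s₀ < R₀)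
    (hρ : ∀ (k : ℕ) (P P' : ι → ℝ) (M : ℝ), (∀ y, |P y - P' y| ≤ wt k y * M) → ‖ρ k P - ρ k P'‖ ≤ M)
    (hΨv : ∀ (k : ℕ) (s : ℝ) (P : ι → ℝ) (U : Bg) (X : C.Dom),
      Ψ k s P U X = (G.newTerm act k s U X (ρ k P)).re - (G.newTerm act k s U₀ X (ρ k P)).re + explZ k U X)
    (hocc : ∀ g ∈ W, ∀ g' ∈ W, ∀ k : ℕ, ‖ρ k (T k g' (E g))‖ ≤ s₀) :
    OutputLipschitz E W T Ψ κ wt (fun k => 2 * B₀ k * R₀ / (R₀ ^ 2 - s₀ ^ 2)) := by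
  obtain ⟨ha, hd, hP⟩ := hKP
  intro g hg g' hg' k M hM U X hX
  have hQQ' : ‖ρ k (T k g' (E g)) - ρ k (T k g' (E g'))‖ ≤ M := hρ k _ _ M hM
  have hs : 0 ≤ s₀ := (norm_nonneg _).trans (hocc g hg g' hg' k)
  have hR : 0 < R₀ := lt_of_le_of_lt hs hsR
  have hD : 0 < R₀ ^ 2 - s₀ ^ 2 := by
    rw [show R₀ ^ 2 - s₀ ^ 2 = (R₀ - s₀) * (R₀ + s₀) by ring]
    exact mul_pos (sub_pos.mpr hsR) (by linarith)
  have hM0 : 0 ≤ M := (norm_nonneg _).trans hQQ'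
  -- one cluster sum at an arbitrary background `U'`: the table-polydisc bound
  have key : ∀ U' : Bg, ‖G.newTerm act k (g' k) U' X (ρ k (T k g' (E g))) -
      G.newTerm act k (g' k) U' X (ρ k (T k g' (E g')))‖ ≤
        Real.exp (-(κ * C.d X)) * (B₀ k * R₀ / (R₀ ^ 2 - s₀ ^ 2) * M) := by
    intro U'
    obtain ⟨hhol, hmaj, hkp⟩ := hP g' hg' k U' X hX
    have h1 := norm_clusterSum_sub_le_of_ballKPG_SP (inc := G.inc) (w := fun Q => act k (g' k) U' Q) ha hd hsR hhol
      hmaj hkp (G.pin_mem X) (G.clus_sub X) (G.clus_pin X) (hdec X) (hocc g hg g' hg' k) (hocc g' hg' g' hg' k)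
    have h4 : 0 ≤ (B₀ k * Real.exp (-(κ * C.d X))) * R₀ / (R₀ ^ 2 - s₀ ^ 2) :=
      div_nonneg (mul_nonneg (le_trans (mul_nonneg (ha _) (Real.exp_nonneg _)) (hpin k X hX)) hR.le) hD.le
    calc ‖G.newTerm act k (g' k) U' X (ρ k (T k g' (E g))) - G.newTerm act k (g' k) U' X (ρ k (T k g' (E g')))‖
        ≤ (a (G.pin X) * Real.exp (-(δ X))) * R₀ / (R₀ ^ 2 - s₀ ^ 2) *
            ‖ρ k (T k g' (E g)) - ρ k (T k g' (E g'))‖ := h1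
      _ ≤ (B₀ k * Real.exp (-(κ * C.d X))) * R₀ / (R₀ ^ 2 - s₀ ^ 2) * M :=
          mul_le_mul (div_le_div_of_nonneg_right (mul_le_mul_of_nonneg_right (hpin k X hX) hR.le) hD.le) hQQ'
            (norm_nonneg _) h4
      _ = Real.exp (-(κ * C.d X)) * (B₀ k * R₀ / (R₀ ^ 2 - s₀ ^ 2) * M) := by ring
  rw [hΨv, hΨv]
  have hU := key U
  have hU₀ := key U₀
  calc |(G.newTerm act k (g' k) U X (ρ k (T k g' (E g)))).re - (G.newTerm act k (g' k) U₀ X (ρ k (T k g' (E g)))).re +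
          explZ k U X -
          ((G.newTerm act k (g' k) U X (ρ k (T k g' (E g')))).re -
            (G.newTerm act k (g' k) U₀ X (ρ k (T k g' (E g')))).re + explZ k U X)|
        = |(G.newTerm act k (g' k) U X (ρ k (T k g' (E g))) - G.newTerm act k (g' k) U X (ρ k (T k g' (E g')))).re -
            (G.newTerm act k (g' k) U₀ X (ρ k (T k g' (E g))) -
              G.newTerm act k (g' k) U₀ X (ρ k (T k g' (E g')))).re| := by
          rw [Complex.sub_re, Complex.sub_re]; ring_nf
    _ ≤ ‖G.newTerm act k (g' k) U X (ρ k (T k g' (E g))) - G.newTerm act k (g' k) U X (ρ k (T k g' (E g')))‖ +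
          ‖G.newTerm act k (g' k) U₀ X (ρ k (T k g' (E g))) - G.newTerm act k (g' k) U₀ X (ρ k (T k g' (E g')))‖ :=
          (abs_sub _ _).trans (add_le_add (Complex.abs_re_le_norm _) (Complex.abs_re_le_norm _))
    _ ≤ Real.exp (-(κ * C.d X)) * (B₀ k * R₀ / (R₀ ^ 2 - s₀ ^ 2) * M) +
          Real.exp (-(κ * C.d X)) * (B₀ k * R₀ / (R₀ ^ 2 - s₀ ^ 2) * M) := add_le_add hU hU₀
    _ = Real.exp (-(κ * C.d X)) * (2 * B₀ k * R₀ / (R₀ ^ 2 - s₀ ^ 2) * M) := by ring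

/-- **`OuterLipschitz` FROM POTENTIAL-KPG ON THE RECORD's SHAPE**, table-polydisc constant `2·B₀ k·R₀∕(R₀² − s₀²)`.
[cite: Balaban1988RG2Cluster, Lemma 3 (2.38) p.20 and (2.40)-(2.41) p.21] -/
theorem outerLipschitz_of_potentialKPG_SP_vac {ι : Type} {E : Functional C Bg} {W : Set (ℕ → ℝ)}
    {T : ℕ → (ℕ → ℝ) → (Bg → C.Dom → ℝ) → ι → ℝ} {Ψ : ℕ → ℝ → (ι → ℝ) → Bg → C.Dom → ℝ}
    {act : ℕ → ℝ → Bg → lp (fun _ : A => ℂ) ∞ → G.P → ℂ} {m : ℕ → ℝ → Bg → G.P → ℝ} {a d : G.P → ℝ} {δ : C.Dom → ℝ}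
    {B₀ lam : ℕ → ℝ} {κ s₀ R₀ : ℝ} {wt : ℕ → ι → ℝ} {U₀ : Bg} {explZ : ℕ → Bg → C.Dom → ℝ}
    (ρ : ℕ → (ι → ℝ) → lp (fun _ : A => ℂ) ∞)
    (hfac : Factorises E W T Ψ) (hlast : LastCouplingLipschitz E W T Ψ κ lam) (hKP : G.PotentialKPG W act m a d R₀)
    (hdec : G.DecayExtract δ d) (hpin : G.PinBudget a δ B₀ κ) (hsR : s₀ < R₀)
    (hρ : ∀ (k : ℕ) (P P' : ι → ℝ) (M : ℝ), (∀ y, |P y - P' y| ≤ wt k y * M) → ‖ρ k P - ρ k P'‖ ≤ M)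
    (hΨv : ∀ (k : ℕ) (s : ℝ) (P : ι → ℝ) (U : Bg) (X : C.Dom),
      Ψ k s P U X = (G.newTerm act k s U X (ρ k P)).re - (G.newTerm act k s U₀ X (ρ k P)).re + explZ k U X)
    (hocc : ∀ g ∈ W, ∀ g' ∈ W, ∀ k : ℕ, ‖ρ k (T k g' (E g))‖ ≤ s₀) :
    OuterLipschitz E W T κ wt lam (fun k => 2 * B₀ k * R₀ / (R₀ ^ 2 - s₀ ^ 2)) :=
  outerLipschitz_of_factorisation hfac hlast
    (outputLipschitz_of_potentialKPG_SP_vac G ρ hKP hdec hpin hsR hρ hΨv hocc)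

/-- **ROUTE R3′♯-SP's END ON THE RECORD's SHAPE**: E129's `ne9_and_fadingMemory_of_potentialKPG_perStep_sharp_vac` binder
list VERBATIM at `Pot := ℓ^∞(A;ℂ)` + the scalar `hs₀ : 0 ≤ s₀`, `hpos` re-lettered ⊢ NE9 with the product moduli of rate
`ω + 2B·R₀∕(R₀² − s₀²)·τ̄` and `FadingMemory` of the same rate.  «NE9 ⇐ the named binders».
[cite: Balaban1987RG1, (2.13)-(2.14) p.268; Balaban1988RG2Cluster, Lemma 3 (2.38) p.20, (2.40)-(2.41) p.21 and (1.36) p.9] -/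
theorem ne9_and_fadingMemory_of_potentialKPG_perStep_SP_vac {ι : Type} {E : Functional C Bg} {W : Set (ℕ → ℝ)}
    {Adm : Set (Bg → C.Dom → ℝ)} {T : ℕ → (ℕ → ℝ) → (Bg → C.Dom → ℝ) → ι → ℝ}
    {Ψ : ℕ → ℝ → (ι → ℝ) → Bg → C.Dom → ℝ} {act : ℕ → ℝ → Bg → lp (fun _ : A => ℂ) ∞ → G.P → ℂ}
    {m : ℕ → ℝ → Bg → G.P → ℝ} {a d : G.P → ℝ} {δ : C.Dom → ℝ} {κ s₀ R₀ B ℓ τbar ω : ℝ} {wt : ℕ → ι → ℝ}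
    {τ : ℕ → ℕ → ℝ} {lam : ℕ → ℝ} {U₀ : Bg} {explZ : ℕ → Bg → C.Dom → ℝ}
    (ρ : ℕ → (ι → ℝ) → lp (fun _ : A => ℂ) ∞) (h0 : ScaleZeroFree E W) (hAdm : AdmissibleTerms E W Adm)
    (hres : AdmRestrict Adm) (hadd : ChannelAdditive Adm T) (hsum : ChannelStepSum Adm T)
    (hstep : ChannelSizeAtStepNN Adm T κ wt τ) (hfac : Factorises E W T Ψ) (hlast : LastCouplingLipschitz E W T Ψ κ lam)
    (hKP : G.PotentialKPG W act m a d R₀) (hdec : G.DecayExtract δ d) (hpin : G.PinBudget a δ (fun _ => B) κ)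
    (hsR : s₀ < R₀) (hs₀ : 0 ≤ s₀)
    (hρ : ∀ (k : ℕ) (P P' : ι → ℝ) (M : ℝ), (∀ y, |P y - P' y| ≤ wt k y * M) → ‖ρ k P - ρ k P'‖ ≤ M)
    (hΨv : ∀ (k : ℕ) (s : ℝ) (P : ι → ℝ) (U : Bg) (X : C.Dom),
      Ψ k s P U X = (G.newTerm act k s U X (ρ k P)).re - (G.newTerm act k s U₀ X (ρ k P)).re + explZ k U X)
    (hocc : ∀ g ∈ W, ∀ g' ∈ W, ∀ k : ℕ, ‖ρ k (T k g' (E g))‖ ≤ s₀) (hℓ : 0 ≤ ℓ) (hB : 0 ≤ B) (hτbar : 0 ≤ τbar)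
    (hω : 0 ≤ ω) (hpos : 0 < ω + 2 * B * R₀ / (R₀ ^ 2 - s₀ ^ 2) * τbar) (hlam : ∀ k, lam k ≤ ℓ)
    (hτ : ∀ k j, j ≤ k → 0 ≤ τ k j ∧ τ k j ≤ τbar * ω ^ (k - j)) :
    NE9 E W κ (prodModuli ℓ fun _ => ω + 2 * B * R₀ / (R₀ ^ 2 - s₀ ^ 2) * τbar) ∧
      FadingMemory (ℓ / (ω + 2 * B * R₀ / (R₀ ^ 2 - s₀ ^ 2) * τbar)) (ω + 2 * B * R₀ / (R₀ ^ 2 - s₀ ^ 2) * τbar)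
        (prodModuli ℓ fun _ => ω + 2 * B * R₀ / (R₀ ^ 2 - s₀ ^ 2) * τbar) :=
  have hR : 0 ≤ R₀ := hs₀.trans hsR.le
  have hD : 0 < R₀ ^ 2 - s₀ ^ 2 := by
    rw [show R₀ ^ 2 - s₀ ^ 2 = (R₀ - s₀) * (R₀ + s₀) by ring]
    exact mul_pos (sub_pos.mpr hsR) (by linarith)
  have hc : 0 ≤ 2 * B * R₀ / (R₀ ^ 2 - s₀ ^ 2) := div_nonneg (by positivity) hD.le
  ne9_and_fadingMemory_of_perStepNN h0 hAdm hres hadd hsum hstep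
    (outerLipschitz_of_potentialKPG_SP_vac G ρ hfac hlast hKP hdec hpin hsR hρ hΨv hocc) hℓ hc hτbar hω hpos hlam
    (fun _ => ⟨hc, le_rfl⟩) hτ

omit G in
/-- [folklore] The table-polydisc rate fades iff `2B·τ̄·R₀ < (R₀² − s₀²)(1 − ω)` (E129: `2B·τ̄ < (R₀ − s₀)(1 − ω)`). -/
theorem fade_iff_room_SP_vac {ω B τbar R₀ s₀ : ℝ} (hsR : s₀ < R₀) (hs₀ : 0 ≤ s₀) :
    ω + 2 * B * R₀ / (R₀ ^ 2 - s₀ ^ 2) * τbar < 1 ↔ 2 * B * τbar * R₀ < (R₀ ^ 2 - s₀ ^ 2) * (1 - ω) := by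
  have hD : 0 < R₀ ^ 2 - s₀ ^ 2 := by
    rw [show R₀ ^ 2 - s₀ ^ 2 = (R₀ - s₀) * (R₀ + s₀) by ring]
    exact mul_pos (sub_pos.mpr hsR) (by linarith)
  have h1 : 2 * B * R₀ / (R₀ ^ 2 - s₀ ^ 2) * τbar = 2 * B * τbar * R₀ / (R₀ ^ 2 - s₀ ^ 2) := by ring
  rw [h1]
  constructor
  · intro h
    have h2 : 2 * B * τbar * R₀ / (R₀ ^ 2 - s₀ ^ 2) < 1 - ω := by linarith
    exact ((div_lt_iff₀ hD).1 h2).trans_eq (mul_comm _ _)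
  · intro h
    have h2 : 2 * B * τbar * R₀ < (1 - ω) * (R₀ ^ 2 - s₀ ^ 2) := h.trans_eq (mul_comm _ _)
    have h3 := (div_lt_iff₀ hD).2 h2
    linarith

/-- [folklore] The table-polydisc room CONTAINS E129's room: `2B·τ̄ < (R₀ − s₀)(1 − ω)` ⇒ `2B·τ̄·R₀ < (R₀² − s₀²)(1 − ω)`
(`0 ≤ s₀ < R₀`, `ω ≤ 1`). -/
theorem room_SP_of_room_sharp {ω B τbar R₀ s₀ : ℝ} (hsR : s₀ < R₀) (hs₀ : 0 ≤ s₀) (hω : ω ≤ 1)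
    (h : 2 * B * τbar < (R₀ - s₀) * (1 - ω)) : 2 * B * τbar * R₀ < (R₀ ^ 2 - s₀ ^ 2) * (1 - ω) := by
  have hR : 0 < R₀ := lt_of_le_of_lt hs₀ hsR
  have h3 : (R₀ ^ 2 - s₀ ^ 2) * (1 - ω) = (R₀ - s₀) * (1 - ω) * R₀ + (R₀ - s₀) * (1 - ω) * s₀ := by ring
  rw [h3]
  nlinarith [mul_lt_mul_of_pos_right h hR, mul_nonneg (mul_nonneg (sub_pos.mpr hsR).le (sub_nonneg.mpr hω)) hs₀]

end EndSP

/-! ## §3b Junction with the record: the END at `Ψ := NE9EndApplied.ΨOf` (table `ℓ^∞(ι;ℂ)`, reading `readingρ wt`) -/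

section Record

open Summit.QuantumFields.BalabanUV.T4Continuum.NE9EndApplied
open Summit.QuantumFields.BalabanUV.T4Continuum.NE9TableReading
open Summit.QuantumFields.BalabanUV.T4Continuum.NE9ComplexEncoding (doubleCarriers)

variable {C₀ : Carriers} {E : Type} {ι : Type}

/-- **ROUTE R3′♯-SP's END AT THE RECORD's OWN NEW-TERM MAP `ΨOf`** (reading `readingρ wt` into the TABLE POLYDISC `ℓ^∞(ι;ℂ)`):
§3's END at `Ψ := NE9EndApplied.ΨOf G act wt U₀ explZ`, `hΨv` by `rfl` — E129 §2's binder list + `hs₀ : 0 ≤ s₀` ⊢ NE9 ∧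
FadingMemory at rate `ω + 2B·R₀∕(R₀² − s₀²)·τ̄`.  «NE9 ⇐ the named binders».
[cite: Balaban1987RG1, (2.13)-(2.14) p.268 and (0.23) p.256; Balaban1988RG2Cluster, Lemma 3 (2.38) p.20, (2.40)-(2.41) p.21 and (1.36) p.9] -/
theorem ne9_and_fadingMemory_of_potentialKPG_psiOf_SP (G : ClusterGeom (doubleCarriers C₀))
    {Ef : Functional (doubleCarriers C₀) E} {W : Set (ℕ → ℝ)} {Adm : Set (E → (doubleCarriers C₀).Dom → ℝ)}
    {T : ℕ → (ℕ → ℝ) → (E → (doubleCarriers C₀).Dom → ℝ) → ι → ℝ} {κ s₀ R₀ B ℓ τbar ω : ℝ} {wt : ℕ → ι → ℝ}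
    {τ : ℕ → ℕ → ℝ} {lam : ℕ → ℝ} {act : ℕ → ℝ → E → lp (fun _ : ι => ℂ) ∞ → G.P → ℂ} {m : ℕ → ℝ → E → G.P → ℝ}
    {a d : G.P → ℝ} {δ : (doubleCarriers C₀).Dom → ℝ} {U₀ : E} {explZ : ℕ → E → (doubleCarriers C₀).Dom → ℝ}
    (h0 : ScaleZeroFree Ef W) (hAdm : AdmissibleTerms Ef W Adm) (hres : AdmRestrict Adm)
    (hadd : ChannelAdditive Adm T) (hsum : ChannelStepSum Adm T) (hstep : ChannelSizeAtStepNN Adm T κ wt τ)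
    (hfac : Factorises Ef W T (ΨOf G act wt U₀ explZ))
    (hlast : LastCouplingLipschitz Ef W T (ΨOf G act wt U₀ explZ) κ lam) (hKP : G.PotentialKPG W act m a d R₀)
    (hdec : G.DecayExtract δ d) (hpin : G.PinBudget a δ (fun _ => B) κ) (hsR : s₀ < R₀) (hs₀ : 0 ≤ s₀)
    (hρ : ∀ (k : ℕ) (P P' : ι → ℝ) (M : ℝ), (∀ y, |P y - P' y| ≤ wt k y * M) →
      ‖readingρ wt k P - readingρ wt k P'‖ ≤ M)
    (hocc : ∀ g ∈ W, ∀ g' ∈ W, ∀ k : ℕ, ‖readingρ wt k (T k g' (Ef g))‖ ≤ s₀) (hℓ : 0 ≤ ℓ) (hB : 0 ≤ B)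
    (hτbar : 0 ≤ τbar) (hω : 0 ≤ ω) (hpos : 0 < ω + 2 * B * R₀ / (R₀ ^ 2 - s₀ ^ 2) * τbar) (hlam : ∀ k, lam k ≤ ℓ)
    (hτ : ∀ k j, j ≤ k → 0 ≤ τ k j ∧ τ k j ≤ τbar * ω ^ (k - j)) :
    NE9 Ef W κ (prodModuli ℓ fun _ => ω + 2 * B * R₀ / (R₀ ^ 2 - s₀ ^ 2) * τbar) ∧
      FadingMemory (ℓ / (ω + 2 * B * R₀ / (R₀ ^ 2 - s₀ ^ 2) * τbar)) (ω + 2 * B * R₀ / (R₀ ^ 2 - s₀ ^ 2) * τbar)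
        (prodModuli ℓ fun _ => ω + 2 * B * R₀ / (R₀ ^ 2 - s₀ ^ 2) * τbar) :=
  ne9_and_fadingMemory_of_potentialKPG_perStep_SP_vac G (readingρ wt) h0 hAdm hres hadd hsum hstep hfac hlast hKP hdec
    hpin hsR hs₀ hρ (fun _ _ _ _ _ => rfl) hocc hℓ hB hτbar hω hpos hlam hτ

end Record

/-! ## §3c (leaf-06) The same END in `NE9PencilSizeInduction`'s OCCUPATION-DERIVED form (p258374 §3∕§4 at the SP constant) -/

section SizeInductionSP

variable {C : Carriers} (G : ClusterGeom C) {Bg : Type}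

/-- [folklore] **NE9 ∧ FADING MEMORY ∧ THE TERM SIZE BOUND ON THE POTENTIAL-KPG PATH AT THE TABLE-POLYDISC CONSTANT, OCCUPATION
DERIVED** — `NE9PencilSizeInduction.ne9_and_fadingMemory_of_potentialKPG_vacSub_sizeInduction`'s (p258374 §3) binder list VERBATIM at
`Pot := ℓ^∞(A;ℂ)` + the scalar `hs₀ : 0 ≤ s₀`, `hpos` re-targeted: the occupation `‖ρ k (T k g′ (E g))‖ ≤ s₀` is DERIVED from the size
data (B0) `hbase`, (XZ) `hexplZ`, (N′) `hNsucc : p₀ j + 2B ≤ N (j+1)`, `hNnn`, (R′) `hbox` and the box `h𝒜 : 𝒜 k ⊆ closedBall 0 s₀` by p258374 §2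
`termSize_of_recursion_vacSub_potentialKPG` (KP for `m` only), and fed to §3 ⊢ `TermSize E W κ N ∧ NE9 E W κ (prodModuli ℓ fun _ ↦ ω +
2·B·R₀∕(R₀² − s₀²)·τ̄) ∧ FadingMemory …`.  Displayed analytic inputs: `PotentialKPG`, decay, pin budget, size data, room, box, reading law,
`hlast`.  «NE9 ⇐ the named binders».
[cite: Balaban1987RG1, (2.13)-(2.14) p.268; Balaban1988RG2Cluster, Lemma 3 (2.38) p.20, (2.40)-(2.41) p.21 and (1.36) p.9] -/
theorem ne9_and_fadingMemory_of_potentialKPG_vacSub_sizeInduction_SP {ι : Type} {E : Functional C Bg} {W : Set (ℕ → ℝ)}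
    {Adm : Set (Bg → C.Dom → ℝ)} {T : ℕ → (ℕ → ℝ) → (Bg → C.Dom → ℝ) → ι → ℝ}
    {Ψ : ℕ → ℝ → (ι → ℝ) → Bg → C.Dom → ℝ} {act : ℕ → ℝ → Bg → lp (fun _ : A => ℂ) ∞ → G.P → ℂ}
    {𝒜 : ℕ → Set (lp (fun _ : A => ℂ) ∞)} {m : ℕ → ℝ → Bg → G.P → ℝ} {a d : G.P → ℝ} {δ : C.Dom → ℝ}
    {κ s₀ R₀ B ℓ τbar ω : ℝ} {wt : ℕ → ι → ℝ} {τ : ℕ → ℕ → ℝ} {lam : ℕ → ℝ} {p₀ N : ℕ → ℝ}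
    (ρ : ℕ → (ι → ℝ) → lp (fun _ : A => ℂ) ∞) (U₀ : Bg) (explZ : ℕ → Bg → C.Dom → ℝ)
    (h0 : ScaleZeroFree E W) (hAdm : AdmissibleTerms E W Adm) (hres : AdmRestrict Adm) (hadd : ChannelAdditive Adm T)
    (hsum : ChannelStepSum Adm T) (hstep : ChannelSizeAtStepNN Adm T κ wt τ) (hfac : Factorises E W T Ψ)
    (hlast : LastCouplingLipschitz E W T Ψ κ lam) (hKP : G.PotentialKPG W act m a d R₀) (hdec : G.DecayExtract δ d)
    (hpin : G.PinBudget a δ (fun _ => B) κ) (hsR : s₀ < R₀) (hs₀ : 0 ≤ s₀)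
    (h𝒜 : ∀ k, 𝒜 k ⊆ closedBall (0 : lp (fun _ : A => ℂ) ∞) s₀)
    (hρ : ∀ (k : ℕ) (P P' : ι → ℝ) (M : ℝ), (∀ y, |P y - P' y| ≤ wt k y * M) → ‖ρ k P - ρ k P'‖ ≤ M)
    (hΨv : ∀ (k : ℕ) (s : ℝ) (P : ι → ℝ) (U : Bg) (X : C.Dom),
      Ψ k s P U X = (G.newTerm act k s U X (ρ k P)).re - (G.newTerm act k s U₀ X (ρ k P)).re + explZ k U X)
    -- the size-induction data (B0), (XZ), (N′), (R′) — in place of the occupation hypothesis `hocc`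
    (hexplZ : ∀ (k : ℕ) (U : Bg) (X : C.Dom), C.scale X = k + 1 → |explZ k U X| ≤ Real.exp (-(κ * C.d X)) * p₀ k)
    (hbase : ∀ g ∈ W, ∀ (U : Bg) (X : C.Dom), C.scale X = 0 → |E g U X| ≤ Real.exp (-(κ * C.d X)) * N 0)
    (hNsucc : ∀ j, p₀ j + 2 * B ≤ N (j + 1)) (hNnn : ∀ j, 0 ≤ N j)
    (hbox : ∀ (k : ℕ) (P : ι → ℝ), (∀ y, |P y| ≤ wt k y * sizeRadius τ N k) → ρ k P ∈ 𝒜 k)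
    (hℓ : 0 ≤ ℓ) (hB : 0 ≤ B) (hτbar : 0 ≤ τbar) (hω : 0 ≤ ω) (hpos : 0 < ω + 2 * B * R₀ / (R₀ ^ 2 - s₀ ^ 2) * τbar)
    (hlam : ∀ k, lam k ≤ ℓ) (hτ : ∀ k j, j ≤ k → 0 ≤ τ k j ∧ τ k j ≤ τbar * ω ^ (k - j)) :
    TermSize E W κ N ∧
      NE9 E W κ (prodModuli ℓ fun _ => ω + 2 * B * R₀ / (R₀ ^ 2 - s₀ ^ 2) * τbar) ∧
        FadingMemory (ℓ / (ω + 2 * B * R₀ / (R₀ ^ 2 - s₀ ^ 2) * τbar)) (ω + 2 * B * R₀ / (R₀ ^ 2 - s₀ ^ 2) * τbar)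
          (prodModuli ℓ fun _ => ω + 2 * B * R₀ / (R₀ ^ 2 - s₀ ^ 2) * τbar) := by
  have h𝒜R : ∀ k, 𝒜 k ⊆ ball (0 : lp (fun _ : A => ℂ) ∞) R₀ := fun k Q hQ =>
    mem_ball_zero_iff.2 (lt_of_le_of_lt (mem_closedBall_zero_iff.1 (h𝒜 k hQ)) hsR)
  obtain ⟨hT, hocc⟩ := NE9PencilSizeInduction.termSize_of_recursion_vacSub_potentialKPG G ρ U₀ explZ hAdm
    (channelSizeNN_of_perStepNN hres hsum hstep) hfac hKP h𝒜R hdec hpin hΨv hexplZ hbase hNsucc hNnn hbox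
  have hoccn : ∀ g ∈ W, ∀ g' ∈ W, ∀ k : ℕ, ‖ρ k (T k g' (E g))‖ ≤ s₀ := fun g hg g' hg' k =>
    mem_closedBall_zero_iff.1 (h𝒜 k (hocc g hg g' hg' k))
  exact ⟨hT, ne9_and_fadingMemory_of_potentialKPG_perStep_SP_vac G ρ h0 hAdm hres hadd hsum hstep hfac hlast hKP hdec hpin hsR hs₀
    hρ hΨv hoccn hℓ hB hτbar hω hpos hlam hτ⟩

end SizeInductionSP

section RecordSizeInduction

open Summit.QuantumFields.BalabanUV.T4Continuum.NE9EndApplied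
open Summit.QuantumFields.BalabanUV.T4Continuum.NE9TableReading
open Summit.QuantumFields.BalabanUV.T4Continuum.NE9ComplexEncoding (doubleCarriers)

variable {C₀ : Carriers} {E : Type} {ι : Type}

/-- [folklore] **ROUTE R3′♯-SP's RECORD-SHAPE END AT `ΨOf` WITH THE OCCUPATION DERIVED** (reading `readingρ wt` into the table polydisc
`ℓ^∞(ι;ℂ)`): §3c at `Ψ := NE9EndApplied.ΨOf G act wt U₀ explZ`, `hΨv` by `rfl` — the twin of `NE9PencilSizeInduction`'s p258374 §4
`ne9_and_fadingMemory_of_potentialKPG_vacSub_sizeInduction_psiOf` with `+ hs₀` and the rate `ω + 2B·R₀∕(R₀² − s₀²)·τ̄`; `hlast` and the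
reading's 1-Lipschitz property `hρ` stay displayed.  «NE9 ⇐ the named binders».
[cite: Balaban1987RG1, (2.13)-(2.14) p.268 and (0.23) p.256; Balaban1988RG2Cluster, Lemma 3 (2.38) p.20, (2.40)-(2.41) p.21 and (1.36) p.9] -/
theorem ne9_and_fadingMemory_of_potentialKPG_vacSub_sizeInduction_psiOf_SP (G : ClusterGeom (doubleCarriers C₀))
    {Ef : Functional (doubleCarriers C₀) E} {W : Set (ℕ → ℝ)} {Adm : Set (E → (doubleCarriers C₀).Dom → ℝ)}
    {T : ℕ → (ℕ → ℝ) → (E → (doubleCarriers C₀).Dom → ℝ) → ι → ℝ} {κ s₀ R₀ B ℓ τbar ω : ℝ} {wt : ℕ → ι → ℝ}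
    {τ : ℕ → ℕ → ℝ} {lam : ℕ → ℝ} {p₀ N : ℕ → ℝ} {act : ℕ → ℝ → E → lp (fun _ : ι => ℂ) ∞ → G.P → ℂ}
    {𝒜 : ℕ → Set (lp (fun _ : ι => ℂ) ∞)} {m : ℕ → ℝ → E → G.P → ℝ} {a d : G.P → ℝ} {δ : (doubleCarriers C₀).Dom → ℝ}
    {U₀ : E} {explZ : ℕ → E → (doubleCarriers C₀).Dom → ℝ}
    (h0 : ScaleZeroFree Ef W) (hAdm : AdmissibleTerms Ef W Adm) (hres : AdmRestrict Adm)
    (hadd : ChannelAdditive Adm T) (hsum : ChannelStepSum Adm T) (hstep : ChannelSizeAtStepNN Adm T κ wt τ)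
    (hfac : Factorises Ef W T (ΨOf G act wt U₀ explZ))
    (hlast : LastCouplingLipschitz Ef W T (ΨOf G act wt U₀ explZ) κ lam) (hKP : G.PotentialKPG W act m a d R₀)
    (hdec : G.DecayExtract δ d) (hpin : G.PinBudget a δ (fun _ => B) κ) (hsR : s₀ < R₀) (hs₀ : 0 ≤ s₀)
    (h𝒜 : ∀ k, 𝒜 k ⊆ closedBall (0 : lp (fun _ : ι => ℂ) ∞) s₀)
    (hρ : ∀ (k : ℕ) (P P' : ι → ℝ) (M : ℝ), (∀ y, |P y - P' y| ≤ wt k y * M) →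
      ‖readingρ wt k P - readingρ wt k P'‖ ≤ M)
    (hexplZ : ∀ (k : ℕ) (U : E) (X : (doubleCarriers C₀).Dom), (doubleCarriers C₀).scale X = k + 1 →
      |explZ k U X| ≤ Real.exp (-(κ * (doubleCarriers C₀).d X)) * p₀ k)
    (hbase : ∀ g ∈ W, ∀ (U : E) (X : (doubleCarriers C₀).Dom), (doubleCarriers C₀).scale X = 0 →
      |Ef g U X| ≤ Real.exp (-(κ * (doubleCarriers C₀).d X)) * N 0)
    (hNsucc : ∀ j, p₀ j + 2 * B ≤ N (j + 1)) (hNnn : ∀ j, 0 ≤ N j)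
    (hbox : ∀ (k : ℕ) (P : ι → ℝ), (∀ y, |P y| ≤ wt k y * sizeRadius τ N k) → readingρ wt k P ∈ 𝒜 k)
    (hℓ : 0 ≤ ℓ) (hB : 0 ≤ B) (hτbar : 0 ≤ τbar) (hω : 0 ≤ ω) (hpos : 0 < ω + 2 * B * R₀ / (R₀ ^ 2 - s₀ ^ 2) * τbar)
    (hlam : ∀ k, lam k ≤ ℓ) (hτ : ∀ k j, j ≤ k → 0 ≤ τ k j ∧ τ k j ≤ τbar * ω ^ (k - j)) :
    TermSize Ef W κ N ∧
      NE9 Ef W κ (prodModuli ℓ fun _ => ω + 2 * B * R₀ / (R₀ ^ 2 - s₀ ^ 2) * τbar) ∧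
        FadingMemory (ℓ / (ω + 2 * B * R₀ / (R₀ ^ 2 - s₀ ^ 2) * τbar)) (ω + 2 * B * R₀ / (R₀ ^ 2 - s₀ ^ 2) * τbar)
          (prodModuli ℓ fun _ => ω + 2 * B * R₀ / (R₀ ^ 2 - s₀ ^ 2) * τbar) :=
  ne9_and_fadingMemory_of_potentialKPG_vacSub_sizeInduction_SP G (readingρ wt) U₀ explZ h0 hAdm hres hadd hsum hstep hfac hlast hKP
    hdec hpin hsR hs₀ h𝒜 hρ (fun _ _ _ _ _ => rfl) hexplZ hbase hNsucc hNnn hbox hℓ hB hτbar hω hpos hlam hτ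

end RecordSizeInduction

/-! ## §4 Pricing arithmetic (refuter's letters `z = p̄₀∕B`, `S = R₀∕s_occ`; ω-free lines exact) -/

section Pricing

-- `c_eff(S) = 2S∕(S+1)` at print's box `S = 24∕13` is `48∕37`.
example : (2 : ℚ) * (24 / 13) / (24 / 13 + 1) = 48 / 37 := by norm_num

-- ALIVE (rate < 1, ω-free) iff `c_eff∕(2+z) < S − 1` iff `2 + z > c_eff∕(S − 1) = 624∕407` — every `z ≥ 0`.
example : (48 : ℚ) / 37 / (24 / 13 - 1) = 624 / 407 := by norm_num
example : (624 : ℚ) / 407 < 2 := by norm_num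

-- RATE-LEADS R4♯-SP (`θ = ω + (1−ω)∕S`) iff `c_eff∕(2+z) < (S−1)∕S` iff `2 + z > c_eff·S∕(S−1) = 1152∕407` iff
-- `z > 338∕407 = 2∕(S² − 1)`.
example : (48 : ℚ) / 37 * (24 / 13) / (24 / 13 - 1) = 1152 / 407 := by norm_num
example : (1152 : ℚ) / 407 - 2 = 338 / 407 := by norm_num
example : (2 : ℚ) / ((24 / 13) ^ 2 - 1) = 338 / 407 := by norm_num

-- Rates `μ = ω + (c_eff∕(2+z))·(1−ω)∕(S−1)` at `ω = 1∕13`, `S = 24∕13`, `c_eff = 48∕37`: `z = 0, 1, 2, 3`.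
example : (1 : ℚ) / 13 + 48 / 37 / (2 + 0) * ((1 - 1 / 13) / (24 / 13 - 1)) = 4151 / 5291 := by norm_num
example : (4151 : ℚ) / 5291 < 0.7846 ∧ (0.7845 : ℚ) < 4151 / 5291 := by norm_num
example : (1 : ℚ) / 13 + 48 / 37 / (2 + 1) * ((1 - 1 / 13) / (24 / 13 - 1)) = 2903 / 5291 := by norm_num
example : (2903 : ℚ) / 5291 < 0.5487 ∧ (0.5486 : ℚ) < 2903 / 5291 := by norm_num
example : (1 : ℚ) / 13 + 48 / 37 / (2 + 2) * ((1 - 1 / 13) / (24 / 13 - 1)) = 2279 / 5291 := by norm_num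
example : (2279 : ℚ) / 5291 < 0.4308 ∧ (0.4307 : ℚ) < 2279 / 5291 := by norm_num
example : (1 : ℚ) / 13 + 48 / 37 / (2 + 3) * ((1 - 1 / 13) / (24 / 13 - 1)) = 9523 / 26455 := by norm_num
example : (9523 : ℚ) / 26455 < 0.3600 ∧ (0.3599 : ℚ) < 9523 / 26455 := by norm_num

-- Comparison at `z = 2`, `ω = 1∕13`: R4♯-SP `θ = 15∕26 ≈ 0.5769`; E129 (`c_eff = 2`) `μ = 89∕143 ≈ 0.6224`; here `2279∕5291 ≈ 0.4307`.
example : (1 : ℚ) / 13 + (1 - 1 / 13) / (24 / 13) = 15 / 26 := by norm_num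
example : (1 : ℚ) / 13 + 2 / (2 + 2) * ((1 - 1 / 13) / (24 / 13 - 1)) = 89 / 143 := by norm_num
example : (2279 : ℚ) / 5291 < 15 / 26 ∧ (15 : ℚ) / 26 < 89 / 143 := by norm_num

-- At `z = 0`: alive iff `S² − S − 1 > 0` (i.e. `S > φ`); at `S = 24∕13`: `576 − 312 − 169 = 95 > 0`.
example : (24 : ℚ) ^ 2 - 24 * 13 - 13 ^ 2 = 95 := by norm_num

end Pricing

end Summit.QuantumFields.BalabanUV.T4Continuum.NE9TablePolydiscSPEnd

end
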